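import Summits.QuantumFields.YangMills.Theorems.SwapVirialDeficitBlowUpGnomonicSeamFloorCoords
import HarnessLib

/-!
# STRATUM B IN GNOMONIC LETTERS: at an END hub (`re a = 0`, hub unit `c = ±i`) the points `η = ((0,u₁,u₂), 0, 0, 0)` are EXACTLY FLAT — `F̂(a, ε, η) = 0`
# (free-hands support of ⟨stmt-QuantumFields-24197⟩ `SwapVirialDeficit.SwapGluedStiffness`; region (Rd) «end crossing ∕ stratum B» of LEAD g98's memo5 §2 — the (Rd) twin of
# ✓`gnoDeficit_base_eq_zero`, base_B = hub × x⊥-plane)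

LEAD memo4 §2 ∕ memo5 §2: the flat set of the principal σ-glued ring has, besides the main stratum A (common axis), the stratum B = {`c` pure imaginary, `C₀ = exp(su′)` with `u′ ⊥ c`,
`C₁ = C₀⁻¹`, `C₂ = ±1`}.  In the master gnomonic chart (hub `c = ν(axisPoint a)` on the `i`-axis) stratum B is reached at the END hubs `re a = 0` (`c = i`) with the `x`-letter purely
TRANSVERSE, `η_x = (0, u₁, u₂)`, and `η_y = η_z = η_F = 0`: the slaving `C₁ = c⁻¹·x̂·c·ẑ` then gives `C₁ = x̂⁻¹` AUTOMATICALLY (conjugation by `i` flips the `(j,k)`-part), `C₂ = ±1` is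
central, and all σ-relations hold (`c² = −1` is central).  This file proves it:
* §1 `conj_end_hub` — for an axial unit `A` with `re A = 0`: `Ā·x·A = (re x, imI x, −imJ x, −imK x)` componentwise; `end_hub_components` (`re A = 0`, `(imI A)² = 1` when `re a = 0`);
* §2 ★★ `gnoDeficit_stratumB_eq_zero (ha : a ≠ 0) (hre : a.re = 0) (ε) (hz : ε.2.1 = true) (hF : ε.2.2 = fun _ => true) (u₁ u₂)`:
  `gnoDeficit 0 1 a ε (((0,u₁,u₂), 0), (0, 0)) = 0` — every leader-sign pattern `(ε_x, ε_y)`.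
What is NOT here: the B-point fibre∕base split (base_B = hub × x⊥-plane, fibre_B = (x₀, y, z, η_F)) and its coercivity floors (next), the re-anchored chart of region (Rb).

HONEST LABEL: algebra on landed results; the (TS) regions, ⟨24197⟩ ∕ ⟨24194⟩ ∕ ⟨24497⟩ OPEN; own crux ⟨22884⟩ OPEN (blocked-on ⟨19935⟩); the Yang–Mills mass gap is NOT proved; no summit
is proved by a line.  THEOREMS ONLY (0 `def`, 0 `sorry`), standard axioms.  Width seat ym-line-sfw-p2-w3 g66 (cell ym-idea-1, free hands), `--supports stmt-QuantumFields-24197`.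
References: [cite: tHooft1979]; [cite: Luscher1983, §2]; [folklore].
-/

set_option autoImplicit false

noncomputable section

open MeasureTheory Quaternion
open scoped BigOperators Quaternion
open Literature.MathematicalPhysics.QuantumFieldTheory hiding SU2
open Literature.MathematicalPhysics.QuantumLattice
open Literature.Analysis.Calculus (radialUnit radialUnit_def norm_radialUnit)
open Literature.MathematicalPhysics.QuantumFieldTheory.Balaban1983to89.T4WilsonGaugeFlatDirection (su2Quat_injective)

namespace Summit.QuantumFields.YangMills.Theorems.SwapVirialDeficit.BlowUpRing

open Summit.QuantumFields.YangMills.Theorems.FemtoTransferGap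
open Summit.QuantumFields.YangMills.Theorems.FemtoTransferGap.TT
open Summit.QuantumFields.YangMills.Theorems.VirialFluxGap.RingDeficit
open Summit.QuantumFields.YangMills.Theorems.SwapVirialDeficit.SwapRing
open Summit.QuantumFields.YangMills.Theorems.SwapTwistDeficit.ToronLog (axisPoint)
open Summit.QuantumFields.YangMills.Theorems.SwapVirialDeficit.ZeroModeSigma (norm_axisUnit su2Quat_quatToSU2_eq_radialUnit axisUnit_axial axial_sq_add_sq)

variable {L : ℕ} [NeZero L]

/-! ## §1 The end hub `c = ±i` and conjugation by it -/

omit [NeZero L] in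
/-- At an END hub (`re a = 0`, `a ≠ 0`) the hub unit `A = ν(axisPoint a)` is `±i`: `re A = 0`, `imJ A = imK A = 0`, `(imI A)² = 1`. [folklore] -/
theorem end_hub_components {a : ℍ} (ha : a ≠ 0) (hre : a.re = 0) :
    (radialUnit (axisPoint a)).re = 0 ∧ (radialUnit (axisPoint a)).imJ = 0 ∧ (radialUnit (axisPoint a)).imK = 0 ∧ (radialUnit (axisPoint a)).imI ^ 2 = 1 := by
  obtain ⟨hAre, hAimI, hAimJ, hAimK⟩ := axisUnit_components a
  have h0 : (radialUnit (axisPoint a)).re = 0 := by rw [hAre, hre, mul_zero]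
  have hsq := axial_sq_add_sq (norm_axisUnit ha) hAimJ hAimK
  rw [h0] at hsq
  exact ⟨h0, hAimJ, hAimK, by nlinarith [hsq]⟩

omit [NeZero L] in
/-- ★ Conjugation by an end hub flips the transverse part: for `A` with `re A = 0`, `imJ A = imK A = 0`, `(imI A)² = 1` and any `x`,
`Ā·x·A = (re x, imI x, −imJ x, −imK x)` (components). [folklore] -/
theorem conj_end_hub {A : ℍ} (hA : A.re = 0 ∧ A.imJ = 0 ∧ A.imK = 0 ∧ A.imI ^ 2 = 1) (x : ℍ) :
    (star A * x * A).re = x.re ∧ (star A * x * A).imI = x.imI ∧ (star A * x * A).imJ = -x.imJ ∧ (star A * x * A).imK = -x.imK := by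
  obtain ⟨h0, hJ, hK, hI⟩ := hA
  refine ⟨?_, ?_, ?_, ?_⟩
  · simp only [Quaternion.re_mul, Quaternion.imI_mul, Quaternion.imJ_mul, Quaternion.imK_mul, Quaternion.re_star, Quaternion.imI_star,
      Quaternion.imJ_star, Quaternion.imK_star, h0, hJ, hK]
    linear_combination (x.re) * hI
  · simp only [Quaternion.re_mul, Quaternion.imI_mul, Quaternion.imJ_mul, Quaternion.imK_mul, Quaternion.re_star, Quaternion.imI_star,
      Quaternion.imJ_star, Quaternion.imK_star, h0, hJ, hK]
    linear_combination (x.imI) * hI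
  · simp only [Quaternion.re_mul, Quaternion.imI_mul, Quaternion.imJ_mul, Quaternion.imK_mul, Quaternion.re_star, Quaternion.imI_star,
      Quaternion.imJ_star, Quaternion.imK_star, h0, hJ, hK]
    linear_combination (-x.imJ) * hI
  · simp only [Quaternion.re_mul, Quaternion.imI_mul, Quaternion.imJ_mul, Quaternion.imK_mul, Quaternion.re_star, Quaternion.imI_star,
      Quaternion.imJ_star, Quaternion.imK_star, h0, hJ, hK]
    linear_combination (-x.imK) * hI

/-! ## §2 Stratum B is exactly flat -/

omit [NeZero L] in
/-- A letter over the origin is the real quaternion `gnoSign ε`: `gnoLetter ε 0 = ↑(gnoSign ε)`. [folklore] -/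
theorem gnoLetter_zero_eq_coe (ε : Bool) : gnoLetter ε (0 : Fin 3 → ℝ) = ((gnoSign ε : ℝ) : ℍ) := by
  rw [gnoLetter_eq]
  ext <;> simp [gnomonicQuat]

omit [NeZero L] in
/-- Its radial projection is the same real unit: `ν(gnoLetter ε 0) = ↑(gnoSign ε)`. [folklore] -/
theorem radialUnit_gnoLetter_zero (ε : Bool) : radialUnit (gnoLetter ε (0 : Fin 3 → ℝ)) = ((gnoSign ε : ℝ) : ℍ) := by
  rw [gnoLetter_zero_eq_coe, radialUnit_def, Quaternion.norm_coe, Real.norm_eq_abs]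
  have h : |gnoSign ε| = 1 := by cases ε <;> simp [gnoSign]
  rw [h, inv_one, one_smul]

/-- ★★ **STRATUM B IS EXACTLY FLAT**: for an END hub (`a ≠ 0`, `re a = 0`, so `c = ν(axisPoint a) = ±i`), signs `ε_z = +` and follower signs `+` (leader signs free) and every
transverse `x`-letter `η_x = (0, u₁, u₂)` with `η_y = η_z = η_F = 0`: `gnoDeficit 0 1 a ε (((0,u₁,u₂), 0), (0, 0)) = 0`.  (`C₁ = c⁻¹·x̂·c = x̂⁻¹` by the slaving, `C₂ = ±1` central,
`c² = −1` central.) [cite: tHooft1979] [cite: Luscher1983, §2] -/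
theorem gnoDeficit_stratumB_eq_zero {a : ℍ} (ha : a ≠ 0) (hre : a.re = 0) (ε : GnoSign L) (hz : ε.2.1 = true) (hF : ε.2.2 = fun _ => true) (u₁ u₂ : ℝ) :
    gnoDeficit (fun _ => false) (fun _ => 1) a ε
      ((((![0, u₁, u₂] : Fin 3 → ℝ), (0 : Fin 3 → ℝ)), ((0 : Fin 3 → ℝ), (0 : Fol L → Fin 3 → ℝ))) : GnoCoord L) = 0 := by
  set η₀ : GnoCoord L := ((((![0, u₁, u₂] : Fin 3 → ℝ), (0 : Fin 3 → ℝ)), ((0 : Fin 3 → ℝ), (0 : Fol L → Fin 3 → ℝ))) : GnoCoord L) with hη₀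
  set q : (Fin 4 → SU2) × (Fol L → SU2) := blowUpPoint (L := L) 1 (gnomonicPoint a ε η₀) with hq
  set A : ℍ := radialUnit (axisPoint a) with hA
  set xh : ℍ := radialUnit (gnoLetter ε.1.1 ![0, u₁, u₂]) with hxh
  have hAc := end_hub_components ha hre
  rw [← hA] at hAc
  have hA1 : ‖A‖ = 1 := norm_axisUnit ha
  -- the four leader quaternions
  have h0 : su2Quat (q.1 0) = xh := su2Quat_gnoLeader_zero a ε η₀
  have h2 : su2Quat (q.1 2) = ((gnoSign ε.1.2 : ℝ) : ℍ) := by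
    rw [hq, su2Quat_gnoLeader_two]; exact radialUnit_gnoLetter_zero ε.1.2
  have h3 : su2Quat (q.1 3) = A := su2Quat_gnoLeader_three ha ε η₀
  have h1 : su2Quat (q.1 1) = star A * xh * A := by
    rw [hq, su2Quat_gnoLeader_one ha ε η₀]
    show star (radialUnit (axisPoint a)) * radialUnit (gnoLetter ε.1.1 ![0, u₁, u₂]) * radialUnit (axisPoint a) *
        radialUnit (gnoLetter ε.2.1 (0 : Fin 3 → ℝ)) = _
    rw [hz, gnoLetter_true_zero, radialUnit_one_quat, mul_one]
  -- `C₁ = x̂⁻¹ = star x̂` (the transverse letter is flipped by the end hub)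
  have hxI : xh.imI = 0 := by
    rw [hxh, radialUnit_def, Quaternion.imI_smul, gnoLetter_eq]; simp [gnomonicQuat]
  have hconj := conj_end_hub hAc xh
  have h1' : star A * xh * A = star xh := by
    ext
    · rw [hconj.1, Quaternion.re_star]
    · rw [hconj.2.1, Quaternion.imI_star, hxI, neg_zero]
    · rw [hconj.2.2.1, Quaternion.imJ_star]
    · rw [hconj.2.2.2, Quaternion.imK_star]
  have hx1 : ‖xh‖ = 1 := norm_radialUnit (gnoLetter_ne_zero _ _)
  have hxx : xh * star xh = 1 := by rw [Quaternion.self_mul_star, Quaternion.normSq_eq_norm_mul_self, hx1, mul_one, Quaternion.coe_one]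
  have hxx' : star xh * xh = 1 := by rw [Quaternion.star_mul_self, Quaternion.normSq_eq_norm_mul_self, hx1, mul_one, Quaternion.coe_one]
  -- end hub facts: `star A = -A`, `A * A = -1`
  have hsA : star A = -A := (Quaternion.star_eq_neg).2 hAc.1
  have hAA : A * A = -1 := by
    have h := Quaternion.star_mul_self A
    rw [Quaternion.normSq_eq_norm_mul_self, hA1, mul_one, Quaternion.coe_one, hsA, neg_mul] at h
    rw [← neg_neg (A * A), h]
  have hAsA : A * star A = 1 := by rw [Quaternion.self_mul_star, Quaternion.normSq_eq_norm_mul_self, hA1, mul_one, Quaternion.coe_one]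
  -- the commutation relations of the leaders `0, 1, 2` at the quaternion level
  have hc01 : su2Quat (q.1 0) * su2Quat (q.1 1) = su2Quat (q.1 1) * su2Quat (q.1 0) := by rw [h0, h1, h1', hxx, hxx']
  have hcoe : ∀ p : ℍ, p * su2Quat (q.1 2) = su2Quat (q.1 2) * p := fun p => by rw [h2]; exact (Quaternion.coe_commutes _ _).symm
  -- the σ-relations at the quaternion level
  have hσ0 : su2Quat (q.1 3) * su2Quat (q.1 1) = su2Quat (q.1 0) * su2Quat (q.1 3) := by
    rw [h3, h1, h0, ← mul_assoc, ← mul_assoc, hAsA, one_mul]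
  have hσ1 : su2Quat (q.1 3) * su2Quat (q.1 0) = su2Quat (q.1 1) * su2Quat (q.1 3) := by
    rw [h3, h1, h0, hsA, mul_assoc (-A * xh) A A, hAA]; noncomm_ring
  have hσ2 : su2Quat (q.1 3) * su2Quat (q.1 2) = su2Quat (q.1 2) * su2Quat (q.1 3) := hcoe _
  -- lift to `SU(2)`
  have lift : ∀ {U V U' V' : SU2}, su2Quat U * su2Quat V = su2Quat U' * su2Quat V' → U * V = U' * V' := fun h =>
    su2Quat_injective (by rw [Balaban1983to89.T4HaarSU2Translate.su2Quat_mul, Balaban1983to89.T4HaarSU2Translate.su2Quat_mul]; exact h)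
  unfold gnoDeficit
  rw [← hq, chartDeficit_eq_zero_iff]
  refine ⟨fun μ ν => ?_, fun μ => ?_, fun i => ?_⟩
  · -- pairwise commutation of `C₀, C₁, C₂`
    fin_cases μ <;> fin_cases ν
    · rfl
    · exact lift hc01
    · exact lift (hcoe _)
    · exact lift hc01.symm
    · rfl
    · exact lift (hcoe _)
    · exact lift (hcoe _).symm
    · exact lift (hcoe _).symm
    · rfl
  · fin_cases μ
    · show q.1 (Fin.last 3) * q.1 (Fin.castSucc (Equiv.swap (0 : Fin 3) 1 0)) = q.1 (Fin.castSucc 0) * q.1 (Fin.last 3)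
      rw [Equiv.swap_apply_left]
      exact lift hσ0
    · show q.1 (Fin.last 3) * q.1 (Fin.castSucc (Equiv.swap (0 : Fin 3) 1 1)) = q.1 (Fin.castSucc 1) * q.1 (Fin.last 3)
      rw [Equiv.swap_apply_right]
      exact lift hσ1
    · show q.1 (Fin.last 3) * q.1 (Fin.castSucc (Equiv.swap (0 : Fin 3) 1 2)) = q.1 (Fin.castSucc 2) * q.1 (Fin.last 3)
      rw [Equiv.swap_apply_of_ne_of_ne (by decide) (by decide)]
      exact lift hσ2
  · rw [hq, gnoFollower_eq, hF]
    show quatToSU2 (gnoLetter true (0 : Fin 3 → ℝ)) = 1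
    rw [gnoLetter_true_zero, quatToSU2_one_eq]

end Summit.QuantumFields.YangMills.Theorems.SwapVirialDeficit.BlowUpRing

end
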